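import Summits.Ventures.HodgeRepro2.T5UnitaryThreeCorner

/-!
# T5CartanUnitaryThree — THE CARTAN DECOMPOSITION OF `U(2,1)` PROVED

Blind cell pub-hodge-repro2, seat p8, Tier-5 kernel support (third file: the assembly). The record's unitary
group at an inert place is `U(antidiag(1, u, 1))` (T5AntidiagonalForm, `u` a star-fixed unit of `𝒪_v`);
T5UnitaryHeckeAdjoint consumes its Cartan decomposition as the hypothesis `IsCartanDecomposition`. Here it is
PROVED, on top of T5HermitianThreeElements (the elements) and T5UnitaryThreeCorner (the corner lemma):

* `corner_reduce` — for `g ∈ U(2,1)` whose corner `a = g 0 0 ≠ 0` divides every entry,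
  `n⁻(y, w) · g · n(x, z) = diag(a, e₁, star(a)⁻¹)` with `star e₁ · e₁ = 1`, the unipotent parameters
  `x = −b/a`, `z = −(b x' + c)/a`, `y = −d/a`, `w = −(y' d + p)/a` being integral and the unipotents lying
  in `U(2,1)` by the row-1 / column-1 relations;
* `exists_cartan_of_corner` — hence `g = k₁ · diag(ϖ^k, 1, ϖ^{-k}) · k₂` with `k₁, k₂ ∈ K_U`
  (`a = α ϖ^k`, `diag(a, e₁, star a⁻¹) = diag(α, e₁, star α⁻¹) · diag(ϖ^k, 1, ϖ^{-k})`, `e₁ ∈ R^×`);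
* `mem_range_of_integral` — an element of `U(2,1)` with integral entries lies in `GL₃(R)`
  (`g⁻¹ = J⁻¹ gᴴ J` has integral entries);
* MAIN `isCartanDecomposition_three`: `IsCartanDecomposition R (antidiag(1, u, 1)) Fin.revPerm ϖ` for `R` a
  DVR with fraction field `E`, an involution preserving `R`-integrality, `u` a star-fixed unit of `R`, and a
  uniformiser `ϖ` fixed by the involution — if every entry is integral, `g ∈ K_U` (`m = 0`); otherwise the
  corner lemma gives a corner dividing everything, the Weyl element `J₃` moves it to `(0,0)`, and
  `exists_cartan_of_corner` finishes;
* `heckeAlgebra_mul_comm_three`: `H(U(2,1), K_U)` IS COMMUTATIVE with no Cartan hypothesis — the record's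
  inert-place Hecke algebra, with multiplicity one and self-adjointness following from T5UnitaryHeckeAdjoint.
-/

namespace Summit.Ventures.HodgeRepro2.T5CartanUnitaryThree

open Summit.Ventures.HodgeRepro2 Matrix T5HermitianThreeElements T5UnitaryThreeCorner

variable {R : Type*} [CommRing R] [IsDomain R] [IsDiscreteValuationRing R] {E : Type*} [Field E]
  [StarRing E] [Algebra R E] [IsFractionRing R E]

omit [IsDomain R] [IsDiscreteValuationRing R] [IsFractionRing R E] in
/-- `diag(a, β, star(a)⁻¹) = diag(α, β, star(α)⁻¹) · diag(ϖ^k, 1, ϖ^{-k})` for `a = α ϖ^k`, `star ϖ = ϖ`. -/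
theorem diagonalUnit_factor3 {a : E} (ha : a ≠ 0) (β : Eˣ) (α : Rˣ) (ϖ : R) (hϖ : algebraMap R E ϖ ≠ 0)
    (hϖs : star (algebraMap R E ϖ) = algebraMap R E ϖ) (k : ℤ)
    (hak : a = algebraMap R E α * algebraMap R E ϖ ^ k) :
    T5CartanUniformiser.diagonalUnit
        ![Units.mk0 a ha, β, (Units.mk0 (star a) (T5HyperbolicUnitaryElements.star_ne_zero' ha))⁻¹] =
      T5CartanUniformiser.diagonalUnit ![Units.map (algebraMap R E).toMonoidHom α, β,
          (Units.mk0 (star ((Units.map (algebraMap R E).toMonoidHom α : Eˣ) : E))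
            (T5HyperbolicUnitaryElements.star_ne_zero' (Units.ne_zero _)))⁻¹] *
        T5CartanUniformiser.diagonalUnit (fun i => Units.mk0 (algebraMap R E ϖ) hϖ ^ (![k, 0, -k] i)) := by
  apply Units.ext
  rw [Units.val_mul, coe_diagonalUnit_fin_three, coe_diagonalUnit_fin_three,
    coe_diagonalUnit_zpow_fin_three, Matrix.mul_fin_three, fin_three_eq_iff]
  simp only [Units.val_inv_eq_inv_val, Units.val_mk0, Units.coe_map, RingHom.toMonoidHom_eq_coe,
    MonoidHom.coe_coe, Units.val_zpow_eq_zpow_val]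
  refine ⟨by rw [hak]; ring, by ring, by ring, by ring, by ring, by ring, by ring, by ring, ?_⟩
  rw [hak, star_mul, star_zpow₀, hϖs, mul_inv, _root_.zpow_neg]
  ring

omit [IsDomain R] [IsDiscreteValuationRing R] [Algebra R E] [IsFractionRing R E] in
/-- The upper unipotent `n(x, z)` attached to the first row `(a, b, c)` of `g ∈ U(2,1)` lies in `U(2,1)`:
`x = −b/a`, `z = −(b x' + c)/a` satisfy `z + star z + star x · x / u = 0` by the row-1 relation. -/
theorem upper3_attached_mem (u : E) (hu : star u = u) (hu0 : u ≠ 0) {a b c x z : E} (ha : a ≠ 0)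
    (hx : x = -(b / a)) (hz : z = -(b * (-star x / u) + c) / a)
    (R1 : c * star a + b * u⁻¹ * star b + a * star c = 0) :
    upper3 u x z ∈ T5UnitaryGroupForm.formUnitaryGroup (J3 u) := by
  apply upper3_mem u hu hu0
  have hsa := T5HyperbolicUnitaryElements.star_ne_zero' ha
  have hsx : star x = -(star b / star a) := by rw [hx, star_neg, star_div₀]
  have hsz : star z = -(star b * (-x / u) + star c) / star a := by
    rw [hz, star_div₀, star_neg, star_add, star_mul, star_div₀, star_neg, star_star, hu]
    ring
  rw [hsz, hsx, hz, hsx, hx]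
  have R1' := R1
  field_simp at R1'
  field_simp
  linear_combination -R1'

omit [IsDomain R] [IsDiscreteValuationRing R] [Algebra R E] [IsFractionRing R E] in
/-- The lower unipotent `n⁻(y, w)` attached to the first column `(a, d, p)` of `g ∈ U(2,1)` lies in `U(2,1)`:
`y = −d/a`, `w = −(y' d + p)/a` satisfy `w + star w + u · star y · y = 0` by the column-1 relation. -/
theorem lower3_attached_mem (u : E) (hu : star u = u) {a d p y w : E} (ha : a ≠ 0)
    (hy : y = -(d / a)) (hw : w = -((-(u * star y)) * d + p) / a)
    (C1 : star p * a + star d * u * d + star a * p = 0) :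
    lower3 u y w ∈ T5UnitaryGroupForm.formUnitaryGroup (J3 u) := by
  apply lower3_mem u hu
  have hsa := T5HyperbolicUnitaryElements.star_ne_zero' ha
  have hsy : star y = -(star d / star a) := by rw [hy, star_neg, star_div₀]
  have hsw : star w = -((-(u * y)) * star d + star p) / star a := by
    rw [hw, star_div₀, star_neg, star_add, star_mul, star_neg, star_mul, star_star, hu]
    ring
  rw [hsw, hsy, hw, hsy, hy]
  field_simp
  linear_combination -C1

omit [IsDomain R] [IsDiscreteValuationRing R] [Algebra R E] [IsFractionRing R E] in
/-- THE CORNER REDUCTION, matrix level: `n⁻(y, w) · g · n(x, z)` has first row and first column `(a, 0, 0)`. -/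
theorem lower3_mul_mul_upper3 (u : E) {a b c d e f p q r x z y w : E} (ha : a ≠ 0)
    (hx : x = -(b / a)) (hz : z = -(b * (-star x / u) + c) / a) (hy : y = -(d / a))
    (hw : w = -((-(u * star y)) * d + p) / a) :
    ∃ e₁ f₁ q₂ r₂ : E,
      (lower3 u y w : Matrix (Fin 3) (Fin 3) E) * !![a, b, c; d, e, f; p, q, r] *
        (upper3 u x z : Matrix (Fin 3) (Fin 3) E) = !![a, 0, 0; 0, e₁, f₁; 0, q₂, r₂] := by
  rw [coe_lower3, coe_upper3, Matrix.mul_fin_three, Matrix.mul_fin_three]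
  refine ⟨(y * a + 1 * d + 0 * p) * x + (y * b + 1 * e + 0 * q) * 1 + (y * c + 1 * f + 0 * r) * 0,
    (y * a + 1 * d + 0 * p) * z + (y * b + 1 * e + 0 * q) * (-star x / u) + (y * c + 1 * f + 0 * r) * 1,
    (w * a + -(u * star y) * d + 1 * p) * x + (w * b + -(u * star y) * e + 1 * q) * 1 +
      (w * c + -(u * star y) * f + 1 * r) * 0,
    (w * a + -(u * star y) * d + 1 * p) * z + (w * b + -(u * star y) * e + 1 * q) * (-star x / u) +
      (w * c + -(u * star y) * f + 1 * r) * 1, ?_⟩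
  rw [fin_three_eq_iff]
  refine ⟨by ring, ?_, ?_, ?_, rfl, rfl, ?_, rfl, rfl⟩
  · rw [hx]; field_simp; ring
  · rw [hz, hx]; field_simp; ring
  · rw [hy]; field_simp; ring
  · rw [hw, hy]; field_simp; ring

/-- THE CORNER CASE OF THE CARTAN DECOMPOSITION OF `U(2,1)`: `g ∈ U(antidiag(1,u,1))` whose corner
`a = g 0 0 ≠ 0` divides every entry is `k₁ · diag(ϖ^{m}) · k₂` with `k₁, k₂ ∈ K_U`, `m = ![k, 0, −k]`. -/
theorem exists_cartan_of_corner3 (hstar : ∀ x : E, IsLocalization.IsInteger R x →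
    IsLocalization.IsInteger R (star x)) (u : E) (hu : star u = u) (hu0 : u ≠ 0)
    (huI : IsLocalization.IsInteger R u) (huI' : IsLocalization.IsInteger R u⁻¹)
    (ϖ : R) (hϖ : Irreducible ϖ) (hϖs : star (algebraMap R E ϖ) = algebraMap R E ϖ)
    (g : T5UnitaryGroupForm.formUnitaryGroup (J3 u))
    (ha : ((g : GL (Fin 3) E) : Matrix (Fin 3) (Fin 3) E) 0 0 ≠ 0)
    (hdiv : ∀ k l, IsLocalization.IsInteger R (((g : GL (Fin 3) E) : Matrix (Fin 3) (Fin 3) E) k l /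
      ((g : GL (Fin 3) E) : Matrix (Fin 3) (Fin 3) E) 0 0)) :
    ∃ k₁ ∈ T5UnitaryHeckeAdjoint.hyperspecialSubgroup R (J3 u),
    ∃ k₂ ∈ T5UnitaryHeckeAdjoint.hyperspecialSubgroup R (J3 u),
    ∃ m : Fin 3 → ℤ, (∀ i, m (Fin.revPerm i) = - m i) ∧
      (g : GL (Fin 3) E) = k₁ * T5CartanUniformiser.diagonalUnit
        (fun i => Units.mk0 (algebraMap R E ϖ)
          ((map_ne_zero_iff _ (IsFractionRing.injective R E)).2 hϖ.ne_zero) ^ m i) * k₂ := by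
  set a := ((g : GL (Fin 3) E) : Matrix (Fin 3) (Fin 3) E) 0 0
  set b := ((g : GL (Fin 3) E) : Matrix (Fin 3) (Fin 3) E) 0 1
  set c := ((g : GL (Fin 3) E) : Matrix (Fin 3) (Fin 3) E) 0 2
  set d := ((g : GL (Fin 3) E) : Matrix (Fin 3) (Fin 3) E) 1 0
  set e := ((g : GL (Fin 3) E) : Matrix (Fin 3) (Fin 3) E) 1 1
  set f := ((g : GL (Fin 3) E) : Matrix (Fin 3) (Fin 3) E) 1 2
  set p := ((g : GL (Fin 3) E) : Matrix (Fin 3) (Fin 3) E) 2 0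
  set q := ((g : GL (Fin 3) E) : Matrix (Fin 3) (Fin 3) E) 2 1
  set r := ((g : GL (Fin 3) E) : Matrix (Fin 3) (Fin 3) E) 2 2
  have hg : ((g : GL (Fin 3) E) : Matrix (Fin 3) (Fin 3) E) = !![a, b, c; d, e, f; p, q, r] :=
    Matrix.eta_fin_three _
  obtain ⟨C1, -, -, -, -, -, -, -, -⟩ := (mem_iff_fin_three u (g : GL (Fin 3) E) a b c d e f p q r hg).1 g.2
  obtain ⟨R1, -, -, -, -, -, -, -, -⟩ := row_relations u hu0 (g : GL (Fin 3) E) a b c d e f p q r hg g.2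
  have hsa := T5HyperbolicUnitaryElements.star_ne_zero' ha
  -- the unipotent parameters
  set x : E := -(b / a) with hx
  set z : E := -(b * (-star x / u) + c) / a with hz
  set y : E := -(d / a) with hy
  set w : E := -((-(u * star y)) * d + p) / a with hw
  have hxI : IsLocalization.IsInteger R x := isInteger_neg_div (hdiv 0 1)
  have hx'I : IsLocalization.IsInteger R (-star x / u) := by
    rw [neg_div, div_eq_mul_inv]
    exact isInteger_neg (IsLocalization.isInteger_mul (hstar _ hxI) huI')
  have hzI : IsLocalization.IsInteger R z := by
    have : z = -((b / a) * (-star x / u) + c / a) := by rw [hz]; field_simp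
    rw [this]
    exact isInteger_neg (IsLocalization.isInteger_add (IsLocalization.isInteger_mul (hdiv 0 1) hx'I)
      (hdiv 0 2))
  have hyI : IsLocalization.IsInteger R y := isInteger_neg_div (hdiv 1 0)
  have hy'I : IsLocalization.IsInteger R (u * star y) := IsLocalization.isInteger_mul huI (hstar _ hyI)
  have hwI : IsLocalization.IsInteger R w := by
    have : w = -((-(u * star y)) * (d / a) + p / a) := by rw [hw]; field_simp
    rw [this]
    exact isInteger_neg (IsLocalization.isInteger_add
      (IsLocalization.isInteger_mul (isInteger_neg hy'I) (hdiv 1 0)) (hdiv 2 0))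
  -- the unipotents and their memberships
  have hN : upper3 u x z ∈ T5UnitaryGroupForm.formUnitaryGroup (J3 u) :=
    upper3_attached_mem u hu hu0 ha hx hz R1
  have hL : lower3 u y w ∈ T5UnitaryGroupForm.formUnitaryGroup (J3 u) :=
    lower3_attached_mem u hu ha hy hw C1
  -- the product is diagonal
  obtain ⟨e₁, f₁, q₂, r₂, hP⟩ := lower3_mul_mul_upper3 u (b := b) (c := c) (d := d) (e := e) (f := f)
    (p := p) (q := q) (r := r) ha hx hz hy hw
  have hPmem : lower3 u y w * (g : GL (Fin 3) E) * upper3 u x z ∈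
      T5UnitaryGroupForm.formUnitaryGroup (J3 u) := mul_mem (mul_mem hL g.2) hN
  have hPmat : ((lower3 u y w * (g : GL (Fin 3) E) * upper3 u x z : GL (Fin 3) E) :
      Matrix (Fin 3) (Fin 3) E) = !![a, 0, 0; 0, e₁, f₁; 0, q₂, r₂] := by
    rw [Units.val_mul, Units.val_mul, hg, hP]
  obtain ⟨-, P12, P13, -, P22, P23, -, -, -⟩ :=
    (mem_iff_fin_three u _ a 0 0 0 e₁ f₁ 0 q₂ r₂ hPmat).1 hPmem
  simp only [star_zero, zero_mul, mul_zero, add_zero, zero_add] at P12 P13 P22 P23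
  have hq₂ : q₂ = 0 := by
    have := P12; rcases mul_eq_zero.1 this with h | h
    · exact absurd h hsa
    · exact h
  have hr₂ : r₂ = (star a)⁻¹ := eq_inv_of_mul_eq_one_right P13
  have he₁ : star e₁ * e₁ = 1 := by
    have : star e₁ * e₁ * u = 1 * u := by linear_combination P22
    exact mul_right_cancel₀ hu0 this
  have he₁0 : e₁ ≠ 0 := by
    intro h; rw [h, mul_zero] at he₁; exact zero_ne_one he₁
  have hf₁ : f₁ = 0 := by
    have hse : star e₁ ≠ 0 := T5HyperbolicUnitaryElements.star_ne_zero' he₁0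
    rcases mul_eq_zero.1 P23 with h | h
    · rcases mul_eq_zero.1 h with h' | h'
      · exact absurd h' hse
      · exact absurd h' hu0
    · exact h
  -- the diagonal element as a unit
  have hPunit : lower3 u y w * (g : GL (Fin 3) E) * upper3 u x z =
      T5CartanUniformiser.diagonalUnit ![Units.mk0 a ha, Units.mk0 e₁ he₁0,
        (Units.mk0 (star a) hsa)⁻¹] := by
    apply Units.ext
    rw [hPmat, coe_diagonalUnit_fin_three, Units.val_inv_eq_inv_val, Units.val_mk0, Units.val_mk0,
      Units.val_mk0, hq₂, hr₂, hf₁]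
  -- e₁ is a unit of R
  obtain ⟨he₁I, he₁I'⟩ := T5CartanFinOne.isInteger_and_isInteger_inv_of_star_mul_self (R := R) hstar he₁
  -- a = α ϖ^k
  obtain ⟨α, k, hak⟩ := T5LocalFieldUnitsDecomposition.exists_unit_mul_zpow ϖ hϖ a ha
  have hϖE : algebraMap R E ϖ ≠ 0 := (map_ne_zero_iff _ (IsFractionRing.injective R E)).2 hϖ.ne_zero
  set αE : Eˣ := Units.map (algebraMap R E).toMonoidHom α with hαE
  have hαI : IsLocalization.IsInteger R (αE : E) := ⟨α, rfl⟩
  have hαI' : IsLocalization.IsInteger R ((αE⁻¹ : Eˣ) : E) :=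
    ⟨((α⁻¹ : Rˣ) : R), by rw [hαE, ← map_inv, Units.coe_map]; rfl⟩
  set sE : Eˣ := Units.mk0 (star (αE : E)) (T5HyperbolicUnitaryElements.star_ne_zero' (Units.ne_zero _))
    with hsE
  have hsEI : IsLocalization.IsInteger R ((sE⁻¹ : Eˣ) : E) := by
    rw [Units.val_inv_eq_inv_val, hsE, Units.val_mk0, ← star_inv₀, ← Units.val_inv_eq_inv_val]
    exact hstar _ hαI'
  have hsEI' : IsLocalization.IsInteger R ((sE⁻¹⁻¹ : Eˣ) : E) := by
    rw [inv_inv, hsE, Units.val_mk0]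
    exact hstar _ hαI
  have hfac := diagonalUnit_factor3 ha (Units.mk0 e₁ he₁0) α ϖ hϖE hϖs k hak
  have he₁u : IsLocalization.IsInteger R ((Units.mk0 e₁ he₁0 : Eˣ) : E) := he₁I
  have he₁u' : IsLocalization.IsInteger R (((Units.mk0 e₁ he₁0)⁻¹ : Eˣ) : E) := by
    rw [Units.val_inv_eq_inv_val, Units.val_mk0]; exact he₁I'
  -- assemble
  refine ⟨⟨(lower3 u y w)⁻¹ * T5CartanUniformiser.diagonalUnit ![αE, Units.mk0 e₁ he₁0, sE⁻¹], ?_⟩, ?_,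
    ⟨(upper3 u x z)⁻¹, inv_mem hN⟩, ?_, ![k, 0, -k], ?_, ?_⟩
  · refine mul_mem (inv_mem hL) (diagonalUnit_mem u ?_ he₁)
    rw [Units.val_inv_eq_inv_val, hsE, Units.val_mk0,
      mul_inv_cancel₀ (T5HyperbolicUnitaryElements.star_ne_zero' (Units.ne_zero _))]
  · rw [T5UnitaryHeckeAdjoint.mem_hyperspecialSubgroup_iff]
    refine mul_mem ?_ (diagonalUnit_mem_range hαI hαI' he₁u he₁u' hsEI hsEI')
    rw [lower3_inv]
    refine lower3_mem_range (isInteger_neg hyI) ?_ ?_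
    · exact isInteger_sub (IsLocalization.isInteger_mul hyI (isInteger_neg hy'I)) hwI
    · rw [star_neg, mul_neg]; exact isInteger_neg hy'I
  · rw [T5UnitaryHeckeAdjoint.mem_hyperspecialSubgroup_iff]
    show (upper3 u x z)⁻¹ ∈ (Matrix.GeneralLinearGroup.map (algebraMap R E)).range
    rw [upper3_inv]
    refine upper3_mem_range (isInteger_neg hxI) ?_ ?_
    · exact isInteger_sub (IsLocalization.isInteger_mul hxI hx'I) hzI
    · rw [star_neg, neg_div]
      rw [neg_div] at hx'I
      exact hx'I
  · intro i; fin_cases i <;> simp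
  · show (g : GL (Fin 3) E) = (lower3 u y w)⁻¹ * T5CartanUniformiser.diagonalUnit ![αE, Units.mk0 e₁ he₁0, sE⁻¹] *
      T5CartanUniformiser.diagonalUnit (fun i => Units.mk0 (algebraMap R E ϖ) _ ^ (![k, 0, -k] i)) *
      (upper3 u x z)⁻¹
    have key : (g : GL (Fin 3) E) = (lower3 u y w)⁻¹ *
        (lower3 u y w * (g : GL (Fin 3) E) * upper3 u x z) * (upper3 u x z)⁻¹ := by group
    rw [key, hPunit, hfac, mul_assoc, mul_assoc, mul_assoc, mul_assoc]

/-- THE CARTAN DECOMPOSITION OF `U(2,1)` — the record's unitary group at an inert place: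
`IsCartanDecomposition R (antidiag(1, u, 1)) Fin.revPerm ϖ` for `R` a DVR with fraction field `E`, an
involution of `E` preserving `R`-integrality, `u` a star-fixed unit of `R`, and a uniformiser `ϖ` fixed by
the involution: every `g ∈ U(2,1)` is `k₁ · diag(ϖ^k, 1, ϖ^{-k}) · k₂` with `k₁, k₂ ∈ K_U`. -/
theorem isCartanDecomposition_three
    (hstar : ∀ x : E, IsLocalization.IsInteger R x → IsLocalization.IsInteger R (star x))
    (u : E) (hu : star u = u) (hu0 : u ≠ 0) (huI : IsLocalization.IsInteger R u)
    (huI' : IsLocalization.IsInteger R u⁻¹) (ϖ : R) (hϖ : Irreducible ϖ)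
    (hϖs : star (algebraMap R E ϖ) = algebraMap R E ϖ) :
    T5UnitaryHeckeAdjoint.IsCartanDecomposition R (J3 u) Fin.revPerm
      (Units.mk0 (algebraMap R E ϖ) ((map_ne_zero_iff _ (IsFractionRing.injective R E)).2 hϖ.ne_zero)) := by
  intro g
  by_cases hni : ∃ i j, ¬ IsLocalization.IsInteger R (((g : GL (Fin 3) E) : Matrix (Fin 3) (Fin 3) E) i j)
  · -- a corner divides everything; move it to (0,0) by the Weyl element
    obtain ⟨i, j, hi, hj, hne, hdiv⟩ := exists_corner_dvd hstar u hu hu0 huI huI' g g.2 hni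
    let w : T5UnitaryGroupForm.formUnitaryGroup (J3 u) :=
      ⟨T5CartanDominant.permUnit E (Fin.revPerm : Equiv.Perm (Fin 3)), permUnit_rev3_mem u⟩
    have hwK : w ∈ T5UnitaryHeckeAdjoint.hyperspecialSubgroup R (J3 u) :=
      (T5UnitaryHeckeAdjoint.mem_hyperspecialSubgroup_iff R w).2 (permUnit_rev3_mem_range (R := R))
    set a := ((g : GL (Fin 3) E) : Matrix (Fin 3) (Fin 3) E) 0 0
    set b := ((g : GL (Fin 3) E) : Matrix (Fin 3) (Fin 3) E) 0 1
    set c := ((g : GL (Fin 3) E) : Matrix (Fin 3) (Fin 3) E) 0 2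
    set d := ((g : GL (Fin 3) E) : Matrix (Fin 3) (Fin 3) E) 1 0
    set e := ((g : GL (Fin 3) E) : Matrix (Fin 3) (Fin 3) E) 1 1
    set f := ((g : GL (Fin 3) E) : Matrix (Fin 3) (Fin 3) E) 1 2
    set p := ((g : GL (Fin 3) E) : Matrix (Fin 3) (Fin 3) E) 2 0
    set q := ((g : GL (Fin 3) E) : Matrix (Fin 3) (Fin 3) E) 2 1
    set r := ((g : GL (Fin 3) E) : Matrix (Fin 3) (Fin 3) E) 2 2
    have hg : ((g : GL (Fin 3) E) : Matrix (Fin 3) (Fin 3) E) = !![a, b, c; d, e, f; p, q, r] :=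
      Matrix.eta_fin_three _
    have hgw : ((g * w : T5UnitaryGroupForm.formUnitaryGroup (J3 u)) : GL (Fin 3) E) =
        (g : GL (Fin 3) E) * T5CartanDominant.permUnit E (Fin.revPerm : Equiv.Perm (Fin 3)) := rfl
    have hwg : ((w * g : T5UnitaryGroupForm.formUnitaryGroup (J3 u)) : GL (Fin 3) E) =
        T5CartanDominant.permUnit E (Fin.revPerm : Equiv.Perm (Fin 3)) * (g : GL (Fin 3) E) := rfl
    have hwgw : ((w * g * w : T5UnitaryGroupForm.formUnitaryGroup (J3 u)) : GL (Fin 3) E) =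
        T5CartanDominant.permUnit E (Fin.revPerm : Equiv.Perm (Fin 3)) * (g : GL (Fin 3) E) *
          T5CartanDominant.permUnit E (Fin.revPerm : Equiv.Perm (Fin 3)) := rfl
    have hmatgw : (((g * w : T5UnitaryGroupForm.formUnitaryGroup (J3 u)) : GL (Fin 3) E) :
        Matrix (Fin 3) (Fin 3) E) = !![c, b, a; f, e, d; r, q, p] := by
      rw [hgw, mul_permUnit_rev3 _ a b c d e f p q r hg]
    have hmatwg : (((w * g : T5UnitaryGroupForm.formUnitaryGroup (J3 u)) : GL (Fin 3) E) :
        Matrix (Fin 3) (Fin 3) E) = !![p, q, r; d, e, f; a, b, c] := by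
      rw [hwg, permUnit_rev3_mul _ a b c d e f p q r hg]
    have hmatwgw : (((w * g * w : T5UnitaryGroupForm.formUnitaryGroup (J3 u)) : GL (Fin 3) E) :
        Matrix (Fin 3) (Fin 3) E) = !![r, q, p; f, e, d; c, b, a] := by
      rw [hwgw, mul_permUnit_rev3 _ p q r d e f a b c (permUnit_rev3_mul _ a b c d e f p q r hg)]
    rcases hi with rfl | rfl <;> rcases hj with rfl | rfl
    · exact exists_cartan_of_corner3 hstar u hu hu0 huI huI' ϖ hϖ hϖs g hne hdiv
    · -- corner (0,2): use g * w
      obtain ⟨k₁, hk₁, k₂, hk₂, m, hm, hdec⟩ :=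
        exists_cartan_of_corner3 hstar u hu hu0 huI huI' ϖ hϖ hϖs (g * w) (by rw [hmatgw]; exact hne)
          (by intro k l; rw [hmatgw]; fin_cases k <;> fin_cases l <;> simpa using hdiv _ _)
      refine ⟨k₁, hk₁, k₂ * w⁻¹, mul_mem hk₂ (inv_mem hwK), m, hm, ?_⟩
      rw [Subgroup.coe_mul, Subgroup.coe_inv, ← mul_assoc, ← hdec, hgw]
      exact (mul_inv_cancel_right _ _).symm
    · -- corner (2,0): use w * g
      obtain ⟨k₁, hk₁, k₂, hk₂, m, hm, hdec⟩ :=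
        exists_cartan_of_corner3 hstar u hu hu0 huI huI' ϖ hϖ hϖs (w * g) (by rw [hmatwg]; exact hne)
          (by intro k l; rw [hmatwg]; fin_cases k <;> fin_cases l <;> simpa using hdiv _ _)
      refine ⟨w⁻¹ * k₁, mul_mem (inv_mem hwK) hk₁, k₂, hk₂, m, hm, ?_⟩
      rw [Subgroup.coe_mul, Subgroup.coe_inv, mul_assoc, mul_assoc, ← mul_assoc (k₁ : GL (Fin 3) E),
        ← hdec, hwg]
      exact (inv_mul_cancel_left _ _).symm
    · -- corner (2,2): use w * g * w
      obtain ⟨k₁, hk₁, k₂, hk₂, m, hm, hdec⟩ :=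
        exists_cartan_of_corner3 hstar u hu hu0 huI huI' ϖ hϖ hϖs (w * g * w) (by rw [hmatwgw]; exact hne)
          (by intro k l; rw [hmatwgw]; fin_cases k <;> fin_cases l <;> simpa using hdiv _ _)
      refine ⟨w⁻¹ * k₁, mul_mem (inv_mem hwK) hk₁, k₂ * w⁻¹, mul_mem hk₂ (inv_mem hwK), m, hm, ?_⟩
      simp only [Subgroup.coe_mul, Subgroup.coe_inv]
      have : (g : GL (Fin 3) E) = (w : GL (Fin 3) E)⁻¹ *
          ((w * g * w : T5UnitaryGroupForm.formUnitaryGroup (J3 u)) : GL (Fin 3) E) *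
          (w : GL (Fin 3) E)⁻¹ := by
        simp only [Subgroup.coe_mul]; group
      rw [this, hdec]; group
  · -- every entry integral: g ∈ K_U
    have hent : ∀ i j, IsLocalization.IsInteger R (((g : GL (Fin 3) E) : Matrix (Fin 3) (Fin 3) E) i j) := by
      intro i j
      by_contra h
      exact hni ⟨i, j, h⟩
    refine ⟨g, (T5UnitaryHeckeAdjoint.mem_hyperspecialSubgroup_iff R g).2
      (mem_range_of_entries hstar u hu0 huI huI' g g.2 hent), 1, one_mem _, 0, fun _ => by simp, ?_⟩
    have h1 : T5CartanUniformiser.diagonalUnit (fun i : Fin 3 =>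
        Units.mk0 (algebraMap R E ϖ) ((map_ne_zero_iff _ (IsFractionRing.injective R E)).2 hϖ.ne_zero) ^
          ((0 : Fin 3 → ℤ) i)) = 1 := by
      apply Units.ext
      rw [T5CartanUniformiser.coe_diagonalUnit, Units.val_one]
      simp only [Pi.zero_apply, zpow_zero, Units.val_one, diagonal_one]
    rw [h1, Subgroup.coe_one, mul_one, mul_one]

/-- `H(U(2,1), K_U)` IS COMMUTATIVE — the record's Hecke algebra at an inert place — with NO Cartan
hypothesis: `R` a DVR with finite residue field, `E = Frac R`, an involution preserving `R`-integrality,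
`u` a star-fixed unit of `R`, a uniformiser fixed by the involution
(T5UnitaryHeckeAdjoint + `isCartanDecomposition_three`). -/
theorem heckeAlgebra_mul_comm_three [Finite (IsLocalRing.ResidueField R)]
    (hstar : ∀ x : E, IsLocalization.IsInteger R x → IsLocalization.IsInteger R (star x))
    (u : E) (hu : star u = u) (hu0 : u ≠ 0) (huI : IsLocalization.IsInteger R u)
    (huI' : IsLocalization.IsInteger R u⁻¹) (ϖ : R) (hϖ : Irreducible ϖ)
    (hϖs : star (algebraMap R E ϖ) = algebraMap R E ϖ) (k : Type*) [Field k]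
    (T S : T5HeckePermutationModule.heckeAlgebra k
      (T5UnitaryHeckeAdjoint.hyperspecialSubgroup R (J3 u))) : T * S = S * T :=
  T5UnitaryHeckeAdjoint.heckeAlgebra_mul_comm
    (T5AntidiagonalForm.antidiagonalMatrix_rev_rev ![1, u, 1] (fun i => by fin_cases i <;> rfl))
    (isCartanDecomposition_three hstar u hu hu0 huI huI' ϖ hϖ hϖs) k T S

end Summit.Ventures.HodgeRepro2.T5CartanUnitaryThree
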